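import Summits.CriticalPhenomena.PercolationContinuityZ3.Theses.PercBudgetLadder
import Summits.CriticalPhenomena.PercolationContinuityZ3.Theorems.PinholeClosing.Negative.PinholeClosingBaseline
import Literature.Probability.Percolation.MinOpenCut
import Literature.Probability.Percolation.BlockResampling
import Literature.Probability.Percolation.PercolationEvents
import Literature.Probability.Percolation.CriticalContinuityProofs
import Summits.CriticalPhenomena.PercolationContinuityZ3.Theorems.PercBudgetLadderPinholeClosingStubTightPocketLocal
import Summits.CriticalPhenomena.PercolationContinuityZ3.Theorems.PercBudgetLadderPinholeClosingStubTightPocketExists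
import Summits.CriticalPhenomena.PercolationContinuityZ3.Theorems.PercBudgetLadderPinholeClosingStubBlockDisintegration
import Summits.CriticalPhenomena.PercolationContinuityZ3.Theorems.PercBudgetLadderPinholeClosingStubDoorKill
import Summits.CriticalPhenomena.PercolationContinuityZ3.Theorems.PercBudgetLadderPinholeClosingStubLeverArithmetic
import HarnessLib.Audit

/-!
# Line `pocket-resampling-liveness-mass` (payload slug `Sketch`) — skeleton for crux
# `PercBudgetLadder.PinholeClosing` (stmt-CriticalPhenomena-5249)

Lead: `prover-line-stmt-CriticalPhenomena-5249-1` (rev 3, 2026-08-16: stubs 1–5 LANDED p96747 p96915 p96905 p97142 p97193; the bookkeeping C1–C5 is PROVED in §2; the ONLY open stub is the bet `stub_secondMomentLiveness`; §3b adds the reduction from the WEAKER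
uniform-integrability hypothesis; §4 holds the def-free auxiliary landing registrations `stub_pocketTwoPockets`, `stub_pocketKill`,
`stub_pocketReduction`, `stub_pocketReductionUI`, all PROVED here and being landed as Theorems/PercBudgetLadderPinholeClosingPocket{TwoPockets,Kill,Reduction}.lean).  Source: ideator 5's
`Cruxes/PinholeClosing/SketchIdeator5.lean` (round 2), reshaped into registered, DEF-FREE stubs (pure tree
vocabulary — a stub worker lands `theorem stub_X : <signature verbatim>` in
`namespace Summit.CriticalPhenomena.PercolationContinuityZ3.Theorems` of a
`Theorems/PercBudgetLadderPinholeClosing<Stub>.lean` file `--supports stmt-CriticalPhenomena-5249`, and the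
`sorry` here becomes `Theorems.stub_X`).  The named objects of §0 are DEFINITIONALLY the raw terms of the stubs
and are used only inside the composition.

THE LINE (window `box n → ∂ⁱⁿ box m`, `m = l n`; `P = P_{p_c(ℤ³)}`).  A TIGHT POCKET of `ω` is a minimal admissible
vertex set `A` (`box n ⊆ A ⊆ box m ∖ ∂ⁱⁿ box m`) with `≤ k+1` open boundary edges.  It is a LOCAL event (reads
`ω ∩ edgesTouching A`), it EXISTS on the budget-`(k+1)` event, it is UNIQUE on `{budget = k+1}` and two distinct
tight pockets force budget `≤ k` (submodularity of the open cut function — PROVED in the sketch, copied in §2).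
Resample the exterior of `A`: `hybrid A ω ω'` = `ω` on `edgesTouching A`, `ω'` elsewhere; `revival A ω` =
`P_{ω'}(hybrid has budget exactly k+1)`; liveness mass `D = Σ_{A tight} revival A`.  Then
`E[D] = P(budget = k+1)` (block disintegration + locality + existence/uniqueness), `E[D ; budget(n,2ln) ≤ k] ≥
(1-p_c)^5 · P(budget(n,ln) = k+1)` (a fresh exterior closes the ≤ 5 exterior edges at a door vertex `b`, and
`A ∪ {b}` is then a `≤ k`-door admissible set of the DOUBLED window), `{D > 1} ⊆ {budget(n,ln) ≤ k}`, and
Cauchy–Schwarz with the BET `E[D²] ≤ K(k,l)` gives level `k` of the crux with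
`c' = min(c/2, qc/4, (qc/4)²/max(K,1))`, `q = (1-p_c)^5`.

REGISTERED STUBS (§1): `stub_tightPocketLocal` (S), `stub_tightPocketExists` (S–M), `stub_blockDisintegration` (M),
`stub_doorKill` (M), `stub_leverArithmetic` (S–M) — all five LANDED (wave 1) —; `stub_secondMomentLiveness` (THE BET,
held by the lead, the only `sorry` left).  §2 `leverBookkeeping` (formerly registered as `stub_leverBookkeeping`) is the
measure-theoretic bookkeeping C1–C5 that turns stubs 1–4 into the two aggregate inequalities, now proved in this file.

COMPOSITION (§3, sorry-free): `levelStep_of_stubs`, `PinholeClosing_of : PercBudgetLadder.PinholeClosing`.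
-/

namespace Summit.CriticalPhenomena.PercolationContinuityZ3.Cruxes.PinholeClosing.PocketResampling

open MeasureTheory Finset
open Literature.Probability.Percolation Literature.Probability.LatticeModels
open Summit.CriticalPhenomena.PercolationContinuityZ3.Theses
open Summit.CriticalPhenomena.PercolationContinuityZ3.Theorems.PinholeClosing.Negative
open scoped Classical

noncomputable section

/-! ## §0 Objects (definitionally the raw terms of the stubs) -/

/-- The critical bond measure on ℤ³. -/
abbrev μc : Measure (BondConfig (Site 3)) := bondPercolation (zdGraph 3) (criticalProbI 3)

/-- Budget-`k` blocked event of `box 3 n → ∂ⁱⁿ box 3 m` (verbatim the route's inlined event). -/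
def bEv (k n m : ℕ) : Set (BondConfig (Site 3)) :=
  {ω : BondConfig (Site 3) | ∃ S : Finset (Sym2 (Site 3)), S.card ≤ k ∧ ¬ ∃ x ∈ box 3 n,
    ∃ y ∈ innerBoundary (zdGraph 3) (box 3 m), (ω \ (↑S : Set (Sym2 (Site 3)))) ∈ openConnIn (↑(box 3 m) : Set (Site 3)) x y}

/-- Budget exactly `k+1`. -/
def exactEv (k n m : ℕ) : Set (BondConfig (Site 3)) := bEv (k + 1) n m \ bEv k n m

/-- Open edge-boundary count `c_ω(A)` (lattice edges with exactly one endpoint in `A` that are open). -/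
def openBdry (ω : BondConfig (Site 3)) (A : Finset (Site 3)) : ℕ :=
  ((edgeBoundary (zdGraph 3) A).filter (· ∈ ω)).card

/-- Admissible source sets of the window: contain the source box, avoid the sink sphere. -/
def Admissible (n m : ℕ) (A : Finset (Site 3)) : Prop :=
  box 3 n ⊆ A ∧ A ⊆ box 3 m \ innerBoundary (zdGraph 3) (box 3 m)

/-- `A` is a TIGHT (minimal) `(k+1)`-pocket of `ω`. -/
def IsTightPocket (k n m : ℕ) (ω : BondConfig (Site 3)) (A : Finset (Site 3)) : Prop :=
  Admissible n m A ∧ openBdry ω A ≤ k + 1 ∧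
    ∀ A' : Finset (Site 3), Admissible n m A' → A' ⊂ A → k + 2 ≤ openBdry ω A'

/-- The hybrid configuration: `ω` on the edges touching `A`, `ω'` on all other edges. -/
def hybrid (A : Finset (Site 3)) (ω ω' : BondConfig (Site 3)) : BondConfig (Site 3) :=
  (ω ∩ ↑(edgesTouching (zdGraph 3) A)) ∪ (ω' \ ↑(edgesTouching (zdGraph 3) A))

/-- Revival probability `λ(A, ω)`: a fresh exterior makes the budget exactly `k+1`. -/
def revival (k n m : ℕ) (A : Finset (Site 3)) (ω : BondConfig (Site 3)) : ℝ :=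
  μc.real {ω' : BondConfig (Site 3) | hybrid A ω ω' ∈ exactEv k n m}

/-- The liveness mass `D(ω) = Σ_{A tight} λ(A, ω)`, written as a sum of indicators over ALL `A ⊆ box 3 m`
(`Set.indicator` carries its own classical decidability, so the term is definitionally stable across files). -/
def livenessMass (k n m : ℕ) (ω : BondConfig (Site 3)) : ℝ :=
  ∑ A ∈ (box 3 m).powerset, {ξ : BondConfig (Site 3) | IsTightPocket k n m ξ A}.indicator (revival k n m A) ω

/-- The kill constant `q = (1 - p_c)^5`. -/
def qKill : ℝ := (1 - ((criticalProbI 3 : unitInterval) : ℝ)) ^ 5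

/-- The crux, restated over `bEv` (definitional). -/
theorem pinholeClosing_iff_bEv :
    PercBudgetLadder.PinholeClosing ↔
      ∀ (k l : ℕ) (c : ℝ), 2 ≤ l → 0 < c → ∃ c' : ℝ, 0 < c' ∧ ∀ n : ℕ, 1 ≤ n →
        c ≤ μc.real (bEv (k + 1) n (l * n)) → c' ≤ μc.real (bEv k n (2 * l * n)) :=
  Iff.rfl

/-! ## §1 Registered stubs (DEF-FREE signatures; a worker proves `theorem stub_X` with exactly this type) -/

/-- **Stub 1 (locality + measurability of the tight-pocket event; provable now, S).**  The predicate
"`A` is a tight `(k+1)`-pocket of `ω` for the window `(n, m)`" reads only `ω ∩ edgesTouching A` (every edge of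
`edgeBoundary A'`, `A' ⊆ A`, touches `A`), hence is a cylinder event of the finite edge set `edgesTouching A` and is
measurable (`DeterminedBy.measurableSet_of_finset`, `PercolationEvents.lean`). -/
theorem stub_tightPocketLocal :
    (∀ (k n m : ℕ) (A : Finset (Site 3)) (ω ω' : BondConfig (Site 3)),
      ω ∩ (↑(edgesTouching (zdGraph 3) A) : Set (Sym2 (Site 3))) = ω' ∩ ↑(edgesTouching (zdGraph 3) A) →
      (((box 3 n ⊆ A ∧ A ⊆ box 3 m \ innerBoundary (zdGraph 3) (box 3 m)) ∧
          ((edgeBoundary (zdGraph 3) A).filter (· ∈ ω)).card ≤ k + 1 ∧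
          ∀ A' : Finset (Site 3), (box 3 n ⊆ A' ∧ A' ⊆ box 3 m \ innerBoundary (zdGraph 3) (box 3 m)) →
            A' ⊂ A → k + 2 ≤ ((edgeBoundary (zdGraph 3) A').filter (· ∈ ω)).card) ↔
        ((box 3 n ⊆ A ∧ A ⊆ box 3 m \ innerBoundary (zdGraph 3) (box 3 m)) ∧
          ((edgeBoundary (zdGraph 3) A).filter (· ∈ ω')).card ≤ k + 1 ∧
          ∀ A' : Finset (Site 3), (box 3 n ⊆ A' ∧ A' ⊆ box 3 m \ innerBoundary (zdGraph 3) (box 3 m)) →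
            A' ⊂ A → k + 2 ≤ ((edgeBoundary (zdGraph 3) A').filter (· ∈ ω')).card))) ∧
    (∀ (k n m : ℕ) (A : Finset (Site 3)), MeasurableSet {ω : BondConfig (Site 3) |
        (box 3 n ⊆ A ∧ A ⊆ box 3 m \ innerBoundary (zdGraph 3) (box 3 m)) ∧
          ((edgeBoundary (zdGraph 3) A).filter (· ∈ ω)).card ≤ k + 1 ∧
          ∀ A' : Finset (Site 3), (box 3 n ⊆ A' ∧ A' ⊆ box 3 m \ innerBoundary (zdGraph 3) (box 3 m)) →
            A' ⊂ A → k + 2 ≤ ((edgeBoundary (zdGraph 3) A').filter (· ∈ ω)).card}) :=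
  Theorems.stub_tightPocketLocal  -- LANDED

/-- **Stub 2 (existence of a tight pocket on the budget-`(k+1)` event; provable now, S–M).**  For a lattice
configuration in the budget-`(k+1)` blocked event of the window `(n, m)`, `n < m`: the set `A₀` of vertices of
`box m` joined to `box n` inside `box m` by `ω ∖ S`-open paths (`S` the blocking set) is admissible (it misses the
sink sphere, and it contains `box n`) and every open boundary edge of `A₀` lies in `S` (a vertex of
`box m ∖ ∂ⁱⁿ box m` has all its lattice neighbours in `box m`), so admissible sets with `≤ k+1` open boundary edges
exist; a `⊂`-minimal one (`Finset.exists_minimal` / strong induction on the cardinality) is tight. -/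
theorem stub_tightPocketExists :
    ∀ (k n m : ℕ) (ω : BondConfig (Site 3)), n < m → ω ⊆ (zdGraph 3).edgeSet →
      ω ∈ {ω : BondConfig (Site 3) | ∃ S : Finset (Sym2 (Site 3)), S.card ≤ k + 1 ∧ ¬ ∃ x ∈ box 3 n,
        ∃ y ∈ innerBoundary (zdGraph 3) (box 3 m), (ω \ (↑S : Set (Sym2 (Site 3)))) ∈ openConnIn (↑(box 3 m) : Set (Site 3)) x y} →
      ∃ A : Finset (Site 3),
        (box 3 n ⊆ A ∧ A ⊆ box 3 m \ innerBoundary (zdGraph 3) (box 3 m)) ∧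
        ((edgeBoundary (zdGraph 3) A).filter (· ∈ ω)).card ≤ k + 1 ∧
        ∀ A' : Finset (Site 3), (box 3 n ⊆ A' ∧ A' ⊆ box 3 m \ innerBoundary (zdGraph 3) (box 3 m)) →
          A' ⊂ A → k + 2 ≤ ((edgeBoundary (zdGraph 3) A').filter (· ∈ ω)).card :=
  Theorems.stub_tightPocketExists  -- LANDED

/-- **Stub 3 (finite-block disintegration + measurability of hybrid probabilities; provable now, M).**  For a
finite edge set `T`, a bounded measurable `φ` that reads only `ω ∩ T`, and a measurable event `F`:
`∫ φ · 𝟙_F dP = ∫ φ(ω) · P_{ω'}((ω ∩ T) ∪ (ω' ∖ T) ∈ F) dP(ω)` — "conditionally on the block `T` the rest is a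
fresh sample".  Proof: `(ω ∩ T) ∪ (ω' ∖ T) = resample ↑T (ω', ω)` (`BlockResampling.resample`), whose law under
`P ⊗ P` is `P` (`map_resample_prod` after `Measure.prod_swap`); rewrite the left side as an integral against that
law (`integral_map`), apply Fubini (`integral_prod`, bounded integrand) and `φ(resample T (ω',ω)) = φ(ω)`; the inner
integral of the indicator is the section measure (`integral_indicator_one`).  Measurability of the section
probability: `measurable_measure_prodMk_left` composed with `ENNReal.toReal`. -/
theorem stub_blockDisintegration :
    (∀ (T : Finset (Sym2 (Site 3))) (φ : BondConfig (Site 3) → ℝ) (F : Set (BondConfig (Site 3))),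
      Measurable φ → (∃ B : ℝ, ∀ ω, |φ ω| ≤ B) → (∀ ω, φ ω = φ (ω ∩ ↑T)) → MeasurableSet F →
      ∫ ω, φ ω * F.indicator (fun _ => (1 : ℝ)) ω ∂(bondPercolation (zdGraph 3) (criticalProbI 3)) =
        ∫ ω, φ ω * (bondPercolation (zdGraph 3) (criticalProbI 3)).real
          {ω' : BondConfig (Site 3) | (ω ∩ ↑T) ∪ (ω' \ ↑T) ∈ F} ∂(bondPercolation (zdGraph 3) (criticalProbI 3))) ∧
    (∀ (T : Finset (Sym2 (Site 3))) (F : Set (BondConfig (Site 3))), MeasurableSet F →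
      Measurable fun ω : BondConfig (Site 3) =>
        (bondPercolation (zdGraph 3) (criticalProbI 3)).real {ω' : BondConfig (Site 3) | (ω ∩ ↑T) ∪ (ω' \ ↑T) ∈ F}) :=
  Theorems.stub_blockDisintegration  -- LANDED

/-- **Stub 4 (door kill; provable now, M).**  If `A` is admissible for the window `(n, ln)` with `≤ k+1` open
boundary edges in the lattice configuration `ω`, then a fresh exterior puts the DOUBLED window `(n, 2ln)` in budget
`≤ k` with probability `≥ (1 - p_c)^5`.  Proof: if `A` has `≤ k` open boundary edges, every hybrid (a.s. a lattice
configuration, `Negative.ae_subset`) is blocked at budget `k` already in the window `(n, ln)` (cut property: a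
crossing leaving `A` uses an open boundary edge; cf. `SketchIdeator5.mem_bEv_of_openBdry_le`) hence in `(n, 2ln)`
(`Negative.blockedEv_mono_aspect`).  Otherwise pick an open boundary edge `s(a, b)`, `a ∈ A`, `b ∉ A`; the `≤ 5` lattice
edges at `b` whose other endpoint is outside `A` do not touch `A`, so in the hybrid they are `ω'`-edges, all closed with
probability `(1-p_c)^{#} ≥ (1-p_c)^5` (`bondPercolation_real_setOf_disjoint`); on that event `A ∪ {b}` is admissible for
`(n, 2ln)` (`b ∈ box (ln) ⊆ box (2ln) ∖ ∂ⁱⁿ`, as `a ∉ ∂ⁱⁿ box (ln)` and `ln < 2ln`) with `≤ k` open boundary edges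
(those of `A` not at `b`), and the cut property gives budget `≤ k`. -/
theorem stub_doorKill :
    ∀ (k n l : ℕ) (A : Finset (Site 3)) (ω : BondConfig (Site 3)), 2 ≤ l → 1 ≤ n →
      ω ⊆ (zdGraph 3).edgeSet →
      (box 3 n ⊆ A ∧ A ⊆ box 3 (l * n) \ innerBoundary (zdGraph 3) (box 3 (l * n))) →
      ((edgeBoundary (zdGraph 3) A).filter (· ∈ ω)).card ≤ k + 1 →
      (1 - ((criticalProbI 3 : unitInterval) : ℝ)) ^ 5 ≤ (bondPercolation (zdGraph 3) (criticalProbI 3)).real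
        {ω' : BondConfig (Site 3) | (ω ∩ ↑(edgesTouching (zdGraph 3) A)) ∪ (ω' \ ↑(edgesTouching (zdGraph 3) A)) ∈
          {ξ : BondConfig (Site 3) | ∃ S : Finset (Sym2 (Site 3)), S.card ≤ k ∧ ¬ ∃ x ∈ box 3 n,
            ∃ y ∈ innerBoundary (zdGraph 3) (box 3 (2 * l * n)),
              (ξ \ (↑S : Set (Sym2 (Site 3)))) ∈ openConnIn (↑(box 3 (2 * l * n)) : Set (Site 3)) x y}} :=
  Theorems.stub_doorKill  -- LANDED

/-- **Stub 5 (lever arithmetic; provable now, S–M; pure measure theory).**  For a bounded measurable `D ≥ 0` with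
`∫ D² ≤ K` and `{D > 1} ⊆ G` a.s.: `∫_F D ≤ P(F) + √(K·P(G))` — split `F` along `{D ≤ 1}` (where the integrand is
`≤ 1`) and `{D > 1} ⊆ G`, then Cauchy–Schwarz `∫_G D = ∫ D·𝟙_G ≤ ‖D‖₂ ‖𝟙_G‖₂`
(`integral_mul_le_Lp_mul_Lq_of_nonneg` with `p = q = 2`, or `inner_mul_le_norm_mul_norm` in `L²`). -/
theorem stub_leverArithmetic :
    ∀ (D : BondConfig (Site 3) → ℝ) (F G : Set (BondConfig (Site 3))) (K B : ℝ),
      Measurable D → (∀ ω, 0 ≤ D ω) → (∀ ω, D ω ≤ B) → MeasurableSet F → MeasurableSet G →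
      (∀ᵐ ω ∂(bondPercolation (zdGraph 3) (criticalProbI 3)), 1 < D ω → ω ∈ G) →
      ∫ ω, (D ω) ^ 2 ∂(bondPercolation (zdGraph 3) (criticalProbI 3)) ≤ K →
      ∫ ω in F, D ω ∂(bondPercolation (zdGraph 3) (criticalProbI 3)) ≤
        (bondPercolation (zdGraph 3) (criticalProbI 3)).real F +
          Real.sqrt (K * (bondPercolation (zdGraph 3) (criticalProbI 3)).real G) :=
  Theorems.stub_leverArithmetic  -- LANDED

/-- **Stub 6 (THE BET — uniform second moment of the liveness mass; OPEN; held by the lead).**  For every budget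
level `k` and aspect `l ≥ 2` there is `K` with `E[D_{k,n,ln}²] ≤ K` for all `n ≥ 1`, where `D` is the liveness mass
(inlined: the sum over tight `(k+1)`-pockets `A ⊆ box (ln)` of the probability that a fresh exterior of `A` has budget
exactly `k+1`).  Numerically supported at `k = 0` (kit j015366: `E[D² | M = 0]` saturates in `n` at l = 4, 6, 8);
not implied by the crux nor by the proved `k = 0` rung; plausibly false for `d > 6`. -/
theorem stub_secondMomentLiveness :
    ∀ (k l : ℕ), 2 ≤ l → ∃ K : ℝ, ∀ n : ℕ, 1 ≤ n →
      ∫ ω, (∑ A ∈ (box 3 (l * n)).powerset,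
              {ξ : BondConfig (Site 3) |
                  (box 3 n ⊆ A ∧ A ⊆ box 3 (l * n) \ innerBoundary (zdGraph 3) (box 3 (l * n))) ∧
                  ((edgeBoundary (zdGraph 3) A).filter (· ∈ ξ)).card ≤ k + 1 ∧
                  ∀ A' : Finset (Site 3), (box 3 n ⊆ A' ∧ A' ⊆ box 3 (l * n) \ innerBoundary (zdGraph 3) (box 3 (l * n))) →
                    A' ⊂ A → k + 2 ≤ ((edgeBoundary (zdGraph 3) A').filter (· ∈ ξ)).card}.indicator
              (fun ξ : BondConfig (Site 3) => (bondPercolation (zdGraph 3) (criticalProbI 3)).real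
                {ω' : BondConfig (Site 3) |
                  (ξ ∩ ↑(edgesTouching (zdGraph 3) A)) ∪ (ω' \ ↑(edgesTouching (zdGraph 3) A)) ∈
                    {ζ : BondConfig (Site 3) | ∃ S : Finset (Sym2 (Site 3)), S.card ≤ k + 1 ∧ ¬ ∃ x ∈ box 3 n,
                        ∃ y ∈ innerBoundary (zdGraph 3) (box 3 (l * n)),
                          (ζ \ (↑S : Set (Sym2 (Site 3)))) ∈ openConnIn (↑(box 3 (l * n)) : Set (Site 3)) x y} \
                    {ζ : BondConfig (Site 3) | ∃ S : Finset (Sym2 (Site 3)), S.card ≤ k ∧ ¬ ∃ x ∈ box 3 n,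
                        ∃ y ∈ innerBoundary (zdGraph 3) (box 3 (l * n)),
                          (ζ \ (↑S : Set (Sym2 (Site 3)))) ∈ openConnIn (↑(box 3 (l * n)) : Set (Site 3)) x y}})
              ω) ^ 2
        ∂(bondPercolation (zdGraph 3) (criticalProbI 3)) ≤ K := by
  sorry

/-! ## §2 Bookkeeping (lemmas C1–C5 behind `stub_leverBookkeeping`; stubs 1–4 are used as black boxes) -/

/-! ### §2.1 Pieces adapted from the ideator's sketch (identical definitions) -/

-- adapted from Cruxes/PinholeClosing/SketchIdeator5.lean
/-- Paths of `ω ∖ S` inside the window that start in `A` stay in `A` when every open boundary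
edge of `A` lies in `S` (lattice configurations). -/
theorem stays_of_boundary_subset {A : Finset (Site 3)} {ω : BondConfig (Site 3)}
    {S : Finset (Sym2 (Site 3))} {m : ℕ} (hω : ω ⊆ (zdGraph 3).edgeSet)
    (hS : ∀ e ∈ edgeBoundary (zdGraph 3) A, e ∈ ω → e ∈ S)
    (u v : (↑(box 3 m) : Set (Site 3)))
    (huv : ((openGraph (ω \ ↑S)).induce (↑(box 3 m) : Set (Site 3))).Reachable u v)
    (hu : (u : Site 3) ∈ A) : (v : Site 3) ∈ A := by
  rw [SimpleGraph.reachable_iff_reflTransGen] at huv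
  induction huv with
  | refl => exact hu
  | @tail b c _ hbc ih =>
    simp only [SimpleGraph.induce_adj, openGraph_adj, Set.mem_sdiff, Finset.mem_coe] at hbc
    obtain ⟨⟨hopen, hnotS⟩, _⟩ := hbc
    by_contra hc
    exact hnotS (hS _ ((mem_edgeBoundary_iff).2
      ⟨hω hopen, ⟨(b : Site 3), ih, Sym2.mem_mk_left _ _⟩, ⟨(c : Site 3), hc, Sym2.mem_mk_right _ _⟩⟩)
      hopen)

-- adapted from Cruxes/PinholeClosing/SketchIdeator5.lean
/-- **Cut property.** The open boundary edges of an admissible set form a blocking set: if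
`A` is admissible with `≤ k` open boundary edges then the window is blocked at budget `k`
(lattice configurations). -/
theorem mem_bEv_of_openBdry_le {k n m : ℕ} {ω : BondConfig (Site 3)} {A : Finset (Site 3)}
    (hω : ω ⊆ (zdGraph 3).edgeSet) (hA : Admissible n m A) (hk : openBdry ω A ≤ k) :
    ω ∈ bEv k n m := by
  refine ⟨(edgeBoundary (zdGraph 3) A).filter (· ∈ ω), hk, ?_⟩
  rintro ⟨x, hx, y, hy, hxS, hyS, hr⟩
  have hS : ∀ e ∈ edgeBoundary (zdGraph 3) A, e ∈ ω →
      e ∈ (edgeBoundary (zdGraph 3) A).filter (· ∈ ω) :=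
    fun e he heω => Finset.mem_filter.2 ⟨he, heω⟩
  have hyA : y ∈ A := stays_of_boundary_subset hω hS ⟨x, hxS⟩ ⟨y, hyS⟩ hr (hA.1 hx)
  have hy' := hA.2 hyA
  rw [Finset.mem_sdiff] at hy'
  exact hy'.2 hy

-- adapted from Cruxes/PinholeClosing/SketchIdeator5.lean
/-- Boundary membership of a lattice edge `s(x,y)` in terms of its endpoints. -/
theorem mk_mem_edgeBoundary_iff {X : Finset (Site 3)} {x y : Site 3}
    (hxy : s(x, y) ∈ (zdGraph 3).edgeSet) :
    s(x, y) ∈ edgeBoundary (zdGraph 3) X ↔ (x ∈ X ∧ y ∉ X) ∨ (x ∉ X ∧ y ∈ X) := by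
  rw [mem_edgeBoundary_iff]
  simp only [Sym2.mem_iff]
  constructor
  · rintro ⟨-, ⟨v, hv, rfl | rfl⟩, ⟨w, hw, rfl | rfl⟩⟩ <;> tauto
  · rintro (⟨hx, hy⟩ | ⟨hx, hy⟩)
    · exact ⟨hxy, ⟨x, hx, Or.inl rfl⟩, ⟨y, hy, Or.inr rfl⟩⟩
    · exact ⟨hxy, ⟨y, hy, Or.inr rfl⟩, ⟨x, hx, Or.inl rfl⟩⟩

-- adapted from Cruxes/PinholeClosing/SketchIdeator5.lean
/-- The open-boundary indicator of an edge. -/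
def χ (ω : BondConfig (Site 3)) (X : Finset (Site 3)) (e : Sym2 (Site 3)) : ℕ :=
  if e ∈ ω ∧ e ∈ edgeBoundary (zdGraph 3) X then 1 else 0

-- adapted from Cruxes/PinholeClosing/SketchIdeator5.lean
/-- Pointwise submodularity of the boundary indicator (16-case truth table). -/
theorem χ_submodular (ω : BondConfig (Site 3)) (A B : Finset (Site 3)) (e : Sym2 (Site 3)) :
    χ ω (A ∩ B) e + χ ω (A ∪ B) e ≤ χ ω A e + χ ω B e := by
  induction e using Sym2.ind with
  | _ x y =>
    by_cases he : s(x, y) ∈ (zdGraph 3).edgeSet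
    · by_cases hω : s(x, y) ∈ ω
      · simp only [χ, hω, true_and, mk_mem_edgeBoundary_iff he, Finset.mem_inter, Finset.mem_union]
        by_cases hxA : x ∈ A <;> by_cases hyA : y ∈ A <;> by_cases hxB : x ∈ B <;>
          by_cases hyB : y ∈ B <;> simp [hxA, hyA, hxB, hyB]
      · simp [χ, hω]
    · have h0 : ∀ X : Finset (Site 3), χ ω X s(x, y) = 0 := fun X => by
        simp only [χ, ite_eq_right_iff, one_ne_zero, imp_false, not_and]
        intro _ hb
        exact he ((mem_edgeBoundary_iff).1 hb).1
      simp [h0]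

-- adapted from Cruxes/PinholeClosing/SketchIdeator5.lean
/-- `openBdry` as a sum of indicators over any finset of edges containing the boundary. -/
theorem openBdry_eq_sum {ω : BondConfig (Site 3)} {X : Finset (Site 3)} {T : Finset (Sym2 (Site 3))}
    (hT : edgeBoundary (zdGraph 3) X ⊆ T) : openBdry ω X = ∑ e ∈ T, χ ω X e := by
  unfold openBdry χ
  rw [Finset.sum_ite, Finset.sum_const_zero, add_zero, Finset.sum_const, smul_eq_mul, mul_one]
  congr 1
  ext e
  simp only [Finset.mem_filter]
  constructor
  · rintro ⟨hb, hω⟩; exact ⟨hT hb, hω, hb⟩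
  · rintro ⟨-, hω, hb⟩; exact ⟨hb, hω⟩

-- adapted from Cruxes/PinholeClosing/SketchIdeator5.lean
/-- The edge boundary of `X ⊆ Y` consists of edges touching `Y`. -/
theorem edgeBoundary_subset_edgesTouching_of_subset {X Y : Finset (Site 3)} (h : X ⊆ Y) :
    edgeBoundary (zdGraph 3) X ⊆ edgesTouching (zdGraph 3) Y := by
  intro e he
  rw [mem_edgeBoundary_iff] at he
  rw [mem_edgesTouching_iff]
  obtain ⟨hE, ⟨v, hv, hve⟩, -⟩ := he
  exact ⟨hE, v, h hv, hve⟩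

-- adapted from Cruxes/PinholeClosing/SketchIdeator5.lean
/-- **Submodularity of the open edge-boundary count** (the cut function of the open graph). -/
theorem openBdry_submodular (ω : BondConfig (Site 3)) (A B : Finset (Site 3)) :
    openBdry ω (A ∩ B) + openBdry ω (A ∪ B) ≤ openBdry ω A + openBdry ω B := by
  set T := edgesTouching (zdGraph 3) (A ∪ B)
  rw [openBdry_eq_sum (T := T) (edgeBoundary_subset_edgesTouching_of_subset Finset.inter_subset_union),
    openBdry_eq_sum (T := T) (edgeBoundary_subset_edgesTouching_of_subset subset_rfl),
    openBdry_eq_sum (T := T) (edgeBoundary_subset_edgesTouching_of_subset Finset.subset_union_left),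
    openBdry_eq_sum (T := T) (edgeBoundary_subset_edgesTouching_of_subset Finset.subset_union_right),
    ← Finset.sum_add_distrib, ← Finset.sum_add_distrib]
  exact Finset.sum_le_sum fun e _ => χ_submodular ω A B e

-- adapted from Cruxes/PinholeClosing/SketchIdeator5.lean
/-- **Two distinct tight pockets force the decrement at the same shape**: `A ∩ B` is an admissible
proper subset of one of them, so it has `≥ k+2` open boundary edges, hence `A ∪ B` has `≤ k`
(submodularity), and the cut property applies. -/
theorem twoPocketsDecrement (k n m : ℕ) (ω : BondConfig (Site 3)) (A B : Finset (Site 3))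
    (hω : ω ⊆ (zdGraph 3).edgeSet) (hA : IsTightPocket k n m ω A) (hB : IsTightPocket k n m ω B)
    (hne : A ≠ B) : ω ∈ bEv k n m := by
  have hadmU : Admissible n m (A ∪ B) :=
    ⟨hA.1.1.trans Finset.subset_union_left, Finset.union_subset hA.1.2 hB.1.2⟩
  have hadmI : Admissible n m (A ∩ B) :=
    ⟨Finset.subset_inter hA.1.1 hB.1.1, Finset.inter_subset_left.trans hA.1.2⟩
  have hI : k + 2 ≤ openBdry ω (A ∩ B) := by
    by_cases h : A ⊆ B
    · -- then `A ⊂ B` is an admissible proper subset of the tight pocket `B`: impossible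
      have hss : A ⊂ B := Finset.ssubset_iff_subset_ne.2 ⟨h, hne⟩
      have h1 := hB.2.2 A hA.1 hss
      have h2 := hA.2.1
      omega
    · have hss : A ∩ B ⊂ A :=
        Finset.ssubset_iff_subset_ne.2 ⟨Finset.inter_subset_left, fun heq => h (Finset.inter_eq_left.1 heq)⟩
      exact hA.2.2 _ hadmI hss
  have hU : openBdry ω (A ∪ B) ≤ k := by
    have h1 := openBdry_submodular ω A B
    have h2 := hA.2.1
    have h3 := hB.2.1
    omega
  exact mem_bEv_of_openBdry_le hω hadmU hU

-- adapted from Cruxes/PinholeClosing/SketchIdeator5.lean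
/-- **Uniqueness:** at exact level `k+1` two tight pockets coincide. -/
theorem tightPocket_unique {k n m : ℕ} {ω : BondConfig (Site 3)} {A B : Finset (Site 3)}
    (hω : ω ⊆ (zdGraph 3).edgeSet) (hex : ω ∈ exactEv k n m)
    (hA : IsTightPocket k n m ω A) (hB : IsTightPocket k n m ω B) : A = B := by
  by_contra hne
  exact hex.2 (twoPocketsDecrement k n m ω A B hω hA hB hne)

-- adapted from Cruxes/PinholeClosing/SketchIdeator5.lean
/-- Hence the liveness mass exceeds `1` only on `{budget ≤ k}`: if two distinct tight pockets
exist the configuration is already in `bEv k`. -/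
theorem mem_bEv_of_two_tightPockets {k n m : ℕ} {ω : BondConfig (Site 3)} {A B : Finset (Site 3)}
    (hω : ω ⊆ (zdGraph 3).edgeSet) (hA : IsTightPocket k n m ω A) (hB : IsTightPocket k n m ω B)
    (hne : A ≠ B) : ω ∈ bEv k n m :=
  twoPocketsDecrement k n m ω A B hω hA hB hne

/-! ### §2.2 Named forms of the black-box stubs (definitional bridges) -/

/-- Stub 1 (locality), over the named objects. -/
theorem isTightPocket_congr_inter {k n m : ℕ} {A : Finset (Site 3)} {ω ω' : BondConfig (Site 3)}
    (h : ω ∩ (↑(edgesTouching (zdGraph 3) A) : Set (Sym2 (Site 3))) = ω' ∩ ↑(edgesTouching (zdGraph 3) A)) :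
    IsTightPocket k n m ω A ↔ IsTightPocket k n m ω' A :=
  stub_tightPocketLocal.1 k n m A ω ω' h

/-- Stub 1 (measurability of the tight-pocket event), over the named objects. -/
theorem measurableSet_isTightPocket (k n m : ℕ) (A : Finset (Site 3)) :
    MeasurableSet {ω : BondConfig (Site 3) | IsTightPocket k n m ω A} :=
  stub_tightPocketLocal.2 k n m A

/-- Stub 2 (existence of a tight pocket on the budget-`(k+1)` event), over the named objects. -/
theorem exists_isTightPocket {k n m : ℕ} {ω : BondConfig (Site 3)} (hnm : n < m)
    (hω : ω ⊆ (zdGraph 3).edgeSet) (hb : ω ∈ bEv (k + 1) n m) :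
    ∃ A : Finset (Site 3), IsTightPocket k n m ω A :=
  stub_tightPocketExists k n m ω hnm hω hb

/-- Stub 3 (block disintegration) with the block `T = edgesTouching A`, over the named objects. -/
theorem integral_mul_indicator_eq_integral_mul_hybridProb (A : Finset (Site 3))
    {φ : BondConfig (Site 3) → ℝ} {F : Set (BondConfig (Site 3))} (hφm : Measurable φ)
    (hφb : ∃ B : ℝ, ∀ ω, |φ ω| ≤ B)
    (hφT : ∀ ω, φ ω = φ (ω ∩ ↑(edgesTouching (zdGraph 3) A))) (hF : MeasurableSet F) :
    ∫ ω, φ ω * F.indicator (fun _ => (1 : ℝ)) ω ∂μc =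
      ∫ ω, φ ω * μc.real {ω' : BondConfig (Site 3) | hybrid A ω ω' ∈ F} ∂μc :=
  stub_blockDisintegration.1 (edgesTouching (zdGraph 3) A) φ F hφm hφb hφT hF

/-- Stub 3 (measurability of hybrid probabilities), over the named objects. -/
theorem measurable_hybridProb (A : Finset (Site 3)) {F : Set (BondConfig (Site 3))}
    (hF : MeasurableSet F) :
    Measurable fun ω : BondConfig (Site 3) => μc.real {ω' : BondConfig (Site 3) | hybrid A ω ω' ∈ F} :=
  stub_blockDisintegration.2 (edgesTouching (zdGraph 3) A) F hF

/-- Stub 4 (door kill), over the named objects. -/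
theorem qKill_le_hybridProb {k n l : ℕ} {A : Finset (Site 3)} {ω : BondConfig (Site 3)} (hl : 2 ≤ l)
    (hn : 1 ≤ n) (hω : ω ⊆ (zdGraph 3).edgeSet) (hA : Admissible n (l * n) A)
    (hk : openBdry ω A ≤ k + 1) :
    qKill ≤ μc.real {ω' : BondConfig (Site 3) | hybrid A ω ω' ∈ bEv k n (2 * l * n)} :=
  stub_doorKill k n l A ω hl hn hω hA hk

/-! ### §2.3 Basic facts: measurability of the events, locality of the hybrid -/

/-- `bEv` is measurable (named form of `Negative.measurableSet_blockedEv`). -/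
theorem measurableSet_bEv (k n m : ℕ) : MeasurableSet (bEv k n m) :=
  measurableSet_blockedEv k n m

/-- `exactEv` is measurable. -/
theorem measurableSet_exactEv (k n m : ℕ) : MeasurableSet (exactEv k n m) :=
  (measurableSet_bEv (k + 1) n m).diff (measurableSet_bEv k n m)

/-- The hybrid reads `ω` only through `ω ∩ edgesTouching A`. -/
theorem hybrid_inter (A : Finset (Site 3)) (ω ω' : BondConfig (Site 3)) :
    hybrid A (ω ∩ ↑(edgesTouching (zdGraph 3) A)) ω' = hybrid A ω ω' := by
  unfold hybrid
  rw [Set.inter_assoc, Set.inter_self]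

/-- The revival probability reads `ω` only through `ω ∩ edgesTouching A`. -/
theorem revival_inter (k n m : ℕ) (A : Finset (Site 3)) (ω : BondConfig (Site 3)) :
    revival k n m A (ω ∩ ↑(edgesTouching (zdGraph 3) A)) = revival k n m A ω := by
  unfold revival
  simp_rw [hybrid_inter]

/-- Tightness reads `ω` only through `ω ∩ edgesTouching A`. -/
theorem isTightPocket_inter {k n m : ℕ} {A : Finset (Site 3)} {ω : BondConfig (Site 3)} :
    IsTightPocket k n m (ω ∩ ↑(edgesTouching (zdGraph 3) A)) A ↔ IsTightPocket k n m ω A :=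
  isTightPocket_congr_inter (by rw [Set.inter_assoc, Set.inter_self])

/-- A tight pocket lies in the powerset of the outer box (admissibility). -/
theorem mem_powerset_of_isTightPocket {k n m : ℕ} {ω : BondConfig (Site 3)} {A : Finset (Site 3)}
    (hA : IsTightPocket k n m ω A) : A ∈ (box 3 m).powerset :=
  Finset.mem_powerset.2 (hA.1.2.trans Finset.sdiff_subset)

/-! ### §2.4 C1: measurability of the liveness mass -/

/-- C1a: the revival probability is measurable. -/
theorem measurable_revival (k n m : ℕ) (A : Finset (Site 3)) : Measurable (revival k n m A) :=
  measurable_hybridProb A (measurableSet_exactEv k n m)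

/-- C1b: each term of the liveness mass is measurable. -/
theorem measurable_term (k n m : ℕ) (A : Finset (Site 3)) :
    Measurable ({ξ : BondConfig (Site 3) | IsTightPocket k n m ξ A}.indicator (revival k n m A)) :=
  (measurable_revival k n m A).indicator (measurableSet_isTightPocket k n m A)

/-- **C1**: the liveness mass is measurable. -/
theorem measurable_livenessMass (k n m : ℕ) : Measurable (livenessMass k n m) := by
  unfold livenessMass
  exact Finset.measurable_sum _ fun A _ => measurable_term k n m A

/-! ### §2.5 C2: bounds -/

/-- C2a: `0 ≤ revival`. -/
theorem revival_nonneg (k n m : ℕ) (A : Finset (Site 3)) (ω : BondConfig (Site 3)) :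
    0 ≤ revival k n m A ω :=
  measureReal_nonneg

/-- C2a: `revival ≤ 1`. -/
theorem revival_le_one (k n m : ℕ) (A : Finset (Site 3)) (ω : BondConfig (Site 3)) :
    revival k n m A ω ≤ 1 :=
  measureReal_le_one

/-- C2b: each term of the liveness mass is nonnegative. -/
theorem term_nonneg (k n m : ℕ) (A : Finset (Site 3)) (ω : BondConfig (Site 3)) :
    0 ≤ {ξ : BondConfig (Site 3) | IsTightPocket k n m ξ A}.indicator (revival k n m A) ω :=
  Set.indicator_nonneg (fun ξ _ => revival_nonneg k n m A ξ) ω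

/-- C2b: each term of the liveness mass is at most `1`. -/
theorem term_le_one (k n m : ℕ) (A : Finset (Site 3)) (ω : BondConfig (Site 3)) :
    {ξ : BondConfig (Site 3) | IsTightPocket k n m ξ A}.indicator (revival k n m A) ω ≤ 1 := by
  by_cases h : ω ∈ {ξ : BondConfig (Site 3) | IsTightPocket k n m ξ A}
  · rw [Set.indicator_of_mem h]; exact revival_le_one k n m A ω
  · rw [Set.indicator_of_notMem h]; exact zero_le_one

/-- C2b: each term of the liveness mass has absolute value at most `1`. -/
theorem abs_term_le_one (k n m : ℕ) (A : Finset (Site 3)) (ω : BondConfig (Site 3)) :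
    |{ξ : BondConfig (Site 3) | IsTightPocket k n m ξ A}.indicator (revival k n m A) ω| ≤ 1 :=
  abs_le.2 ⟨by linarith [term_nonneg k n m A ω], term_le_one k n m A ω⟩

/-- **C2**: the liveness mass is nonnegative. -/
theorem livenessMass_nonneg (k n m : ℕ) (ω : BondConfig (Site 3)) : 0 ≤ livenessMass k n m ω :=
  Finset.sum_nonneg fun A _ => term_nonneg k n m A ω

/-- **C2**: the liveness mass is at most the number of subsets of the outer box. -/
theorem livenessMass_le (k n m : ℕ) (ω : BondConfig (Site 3)) :
    livenessMass k n m ω ≤ (2 : ℝ) ^ (box 3 m).card := by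
  unfold livenessMass
  calc ∑ A ∈ (box 3 m).powerset, {ξ : BondConfig (Site 3) | IsTightPocket k n m ξ A}.indicator (revival k n m A) ω
      ≤ ∑ A ∈ (box 3 m).powerset, (1 : ℝ) := Finset.sum_le_sum fun A _ => term_le_one k n m A ω
    _ = (2 : ℝ) ^ (box 3 m).card := by
      rw [Finset.sum_const, Finset.card_powerset, nsmul_eq_mul, mul_one]
      push_cast
      rfl

/-! ### §2.6 C3: the liveness identity `E[D] = P(budget = k+1)` -/

/-- Bounded measurable real functions are `μc`-integrable. -/
theorem integrable_of_abs_le {f : BondConfig (Site 3) → ℝ} (hf : Measurable f) {C : ℝ}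
    (hC : ∀ ω, |f ω| ≤ C) : Integrable f μc :=
  Integrable.of_bound hf.aestronglyMeasurable C
    (Filter.Eventually.of_forall fun ω => by rw [Real.norm_eq_abs]; exact hC ω)

/-- Each term of the liveness mass is integrable. -/
theorem integrable_term (k n m : ℕ) (A : Finset (Site 3)) :
    Integrable ({ξ : BondConfig (Site 3) | IsTightPocket k n m ξ A}.indicator (revival k n m A)) μc :=
  integrable_of_abs_le (measurable_term k n m A) (abs_term_le_one k n m A)

/-- The term of the liveness mass at `A` as the tightness indicator times the revival probability. -/
theorem term_eq_mul (k n m : ℕ) (A : Finset (Site 3)) (ω : BondConfig (Site 3)) :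
    {ξ : BondConfig (Site 3) | IsTightPocket k n m ξ A}.indicator (revival k n m A) ω =
      {ξ : BondConfig (Site 3) | IsTightPocket k n m ξ A}.indicator (fun _ => (1 : ℝ)) ω *
        revival k n m A ω := by
  by_cases h : ω ∈ {ξ : BondConfig (Site 3) | IsTightPocket k n m ξ A}
  · rw [Set.indicator_of_mem h, Set.indicator_of_mem h, one_mul]
  · rw [Set.indicator_of_notMem h, Set.indicator_of_notMem h, zero_mul]

/-- The tightness indicator reads `ω` only through `ω ∩ edgesTouching A`. -/
theorem tightInd_inter (k n m : ℕ) (A : Finset (Site 3)) (ω : BondConfig (Site 3)) :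
    {ξ : BondConfig (Site 3) | IsTightPocket k n m ξ A}.indicator (fun _ => (1 : ℝ)) ω =
      {ξ : BondConfig (Site 3) | IsTightPocket k n m ξ A}.indicator (fun _ => (1 : ℝ))
        (ω ∩ ↑(edgesTouching (zdGraph 3) A)) := by
  by_cases h : IsTightPocket k n m ω A
  · have h' : IsTightPocket k n m (ω ∩ ↑(edgesTouching (zdGraph 3) A)) A := isTightPocket_inter.2 h
    rw [Set.indicator_of_mem (show ω ∈ {ξ | IsTightPocket k n m ξ A} from h),
      Set.indicator_of_mem (show ω ∩ ↑(edgesTouching (zdGraph 3) A) ∈ {ξ | IsTightPocket k n m ξ A} from h')]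
  · have h' : ¬ IsTightPocket k n m (ω ∩ ↑(edgesTouching (zdGraph 3) A)) A := fun h' => h (isTightPocket_inter.1 h')
    rw [Set.indicator_of_notMem (show ω ∉ {ξ | IsTightPocket k n m ξ A} from h),
      Set.indicator_of_notMem (show ω ∩ ↑(edgesTouching (zdGraph 3) A) ∉ {ξ | IsTightPocket k n m ξ A} from h')]

/-- The term of the liveness mass reads `ω` only through `ω ∩ edgesTouching A`. -/
theorem term_inter (k n m : ℕ) (A : Finset (Site 3)) (ω : BondConfig (Site 3)) :
    {ξ : BondConfig (Site 3) | IsTightPocket k n m ξ A}.indicator (revival k n m A) ω =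
      {ξ : BondConfig (Site 3) | IsTightPocket k n m ξ A}.indicator (revival k n m A)
        (ω ∩ ↑(edgesTouching (zdGraph 3) A)) := by
  rw [term_eq_mul, term_eq_mul, revival_inter, ← tightInd_inter]

/-- The tightness indicator has absolute value at most `1`. -/
theorem abs_tightInd_le_one (k n m : ℕ) (A : Finset (Site 3)) (ω : BondConfig (Site 3)) :
    |{ξ : BondConfig (Site 3) | IsTightPocket k n m ξ A}.indicator (fun _ => (1 : ℝ)) ω| ≤ 1 := by
  by_cases h : ω ∈ {ξ : BondConfig (Site 3) | IsTightPocket k n m ξ A}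
  · rw [Set.indicator_of_mem h]; simp
  · rw [Set.indicator_of_notMem h]; simp

/-- Indicator of an intersection as a product of indicators (constant-one version). -/
theorem indicator_inter_one_mul (s t : Set (BondConfig (Site 3))) (ω : BondConfig (Site 3)) :
    (s ∩ t).indicator (fun _ => (1 : ℝ)) ω = s.indicator (fun _ => (1 : ℝ)) ω * t.indicator (fun _ => (1 : ℝ)) ω := by
  by_cases hs : ω ∈ s <;> by_cases ht : ω ∈ t <;> simp [hs, ht]

/-- C3a: per-pocket identity `∫ 𝟙_{tight A} · revival A = ∫ 𝟙_{tight A ∩ exact}` (block disintegration with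
`φ = 𝟙_{tight A}`, `F = exact`). -/
theorem integral_term_eq (k n m : ℕ) (A : Finset (Site 3)) :
    ∫ ω, {ξ : BondConfig (Site 3) | IsTightPocket k n m ξ A}.indicator (revival k n m A) ω ∂μc =
      ∫ ω, ({ξ : BondConfig (Site 3) | IsTightPocket k n m ξ A} ∩ exactEv k n m).indicator
        (fun _ => (1 : ℝ)) ω ∂μc := by
  have h := integral_mul_indicator_eq_integral_mul_hybridProb A
    (φ := {ξ : BondConfig (Site 3) | IsTightPocket k n m ξ A}.indicator fun _ => (1 : ℝ))
    (F := exactEv k n m) (measurable_const.indicator (measurableSet_isTightPocket k n m A))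
    ⟨1, abs_tightInd_le_one k n m A⟩ (tightInd_inter k n m A) (measurableSet_exactEv k n m)
  calc ∫ ω, {ξ : BondConfig (Site 3) | IsTightPocket k n m ξ A}.indicator (revival k n m A) ω ∂μc
      = ∫ ω, {ξ : BondConfig (Site 3) | IsTightPocket k n m ξ A}.indicator (fun _ => (1 : ℝ)) ω *
          revival k n m A ω ∂μc := by
        simp_rw [term_eq_mul]
    _ = ∫ ω, {ξ : BondConfig (Site 3) | IsTightPocket k n m ξ A}.indicator (fun _ => (1 : ℝ)) ω *
          (exactEv k n m).indicator (fun _ => (1 : ℝ)) ω ∂μc := h.symm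
    _ = _ := by
        simp_rw [indicator_inter_one_mul]

/-- C3b: `∫ D = Σ_A ∫ term_A`. -/
theorem integral_livenessMass (k n m : ℕ) :
    ∫ ω, livenessMass k n m ω ∂μc =
      ∑ A ∈ (box 3 m).powerset,
        ∫ ω, {ξ : BondConfig (Site 3) | IsTightPocket k n m ξ A}.indicator (revival k n m A) ω ∂μc := by
  unfold livenessMass
  exact integral_finsetSum _ fun A _ => integrable_term k n m A

/-- C3c: on a lattice configuration (`n < m`) the sum over `A ⊆ box m` of the indicators of
`{tight A} ∩ exact` is the indicator of `exact` (existence: stub 2; uniqueness: `tightPocket_unique`). -/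
theorem sum_indicator_tight_inter_exact {k n m : ℕ} (hnm : n < m) {ω : BondConfig (Site 3)}
    (hω : ω ⊆ (zdGraph 3).edgeSet) :
    ∑ A ∈ (box 3 m).powerset, ({ξ : BondConfig (Site 3) | IsTightPocket k n m ξ A} ∩ exactEv k n m).indicator
        (fun _ => (1 : ℝ)) ω = (exactEv k n m).indicator (fun _ => (1 : ℝ)) ω := by
  by_cases hex : ω ∈ exactEv k n m
  · obtain ⟨A₀, hA₀⟩ := exists_isTightPocket (k := k) hnm hω hex.1
    rw [Set.indicator_of_mem hex, Finset.sum_eq_single_of_mem A₀ (mem_powerset_of_isTightPocket hA₀)]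
    · exact Set.indicator_of_mem
        (show ω ∈ {ξ : BondConfig (Site 3) | IsTightPocket k n m ξ A₀} ∩ exactEv k n m from ⟨hA₀, hex⟩) _
    · intro A _ hne
      refine Set.indicator_of_notMem ?_ _
      rintro ⟨hA, -⟩
      exact hne (tightPocket_unique hω hex hA hA₀)
  · refine (Finset.sum_eq_zero fun A _ => ?_).trans (Set.indicator_of_notMem hex _).symm
    exact Set.indicator_of_notMem (fun h => hex h.2) _

/-- **C3**: the liveness identity `E[D] = P(budget = k+1)` (`n < m`). -/
theorem integral_livenessMass_eq {k n m : ℕ} (hnm : n < m) :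
    ∫ ω, livenessMass k n m ω ∂μc = μc.real (exactEv k n m) := by
  rw [integral_livenessMass]
  simp_rw [integral_term_eq]
  rw [← integral_finsetSum _ fun A _ => integrable_of_abs_le
    (measurable_const.indicator ((measurableSet_isTightPocket k n m A).inter (measurableSet_exactEv k n m)))
    (C := 1) (fun ω => ?_)]
  · have hae : ∀ᵐ ω ∂μc, ∑ A ∈ (box 3 m).powerset,
        ({ξ : BondConfig (Site 3) | IsTightPocket k n m ξ A} ∩ exactEv k n m).indicator (fun _ => (1 : ℝ)) ω =
          (exactEv k n m).indicator (fun _ => (1 : ℝ)) ω := by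
      filter_upwards [ae_subset] with ω hω using sum_indicator_tight_inter_exact hnm hω
    rw [integral_congr_ae hae, integral_indicator_const (1 : ℝ) (measurableSet_exactEv k n m), smul_eq_mul,
      mul_one]
  · by_cases h : ω ∈ {ξ : BondConfig (Site 3) | IsTightPocket k n m ξ A} ∩ exactEv k n m
    · rw [Set.indicator_of_mem h]; simp
    · rw [Set.indicator_of_notMem h]; simp

/-! ### §2.7 C4: the kill inequality -/

/-- C4a: per-pocket kill `q · ∫ term_A ≤ ∫ term_A · 𝟙_{bEv k n (2ln)}` (block disintegration with
`φ = term_A`, `F = bEv k n (2ln)`, then the door kill on the tight event). -/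
theorem qKill_mul_integral_term_le {k n l : ℕ} (hl : 2 ≤ l) (hn : 1 ≤ n) (A : Finset (Site 3)) :
    qKill * ∫ ω, {ξ : BondConfig (Site 3) | IsTightPocket k n (l * n) ξ A}.indicator (revival k n (l * n) A) ω ∂μc ≤
      ∫ ω, {ξ : BondConfig (Site 3) | IsTightPocket k n (l * n) ξ A}.indicator (revival k n (l * n) A) ω *
        (bEv k n (2 * l * n)).indicator (fun _ => (1 : ℝ)) ω ∂μc := by
  rw [integral_mul_indicator_eq_integral_mul_hybridProb A (measurable_term k n (l * n) A)
    ⟨1, abs_term_le_one k n (l * n) A⟩ (term_inter k n (l * n) A) (measurableSet_bEv k n (2 * l * n)),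
    ← integral_const_mul]
  refine integral_mono_ae ((integrable_term k n (l * n) A).const_mul qKill) ?_ ?_
  · refine integrable_of_abs_le ((measurable_term k n (l * n) A).mul
      (measurable_hybridProb A (measurableSet_bEv k n (2 * l * n)))) (C := 1) fun ω => ?_
    rw [abs_mul]
    exact mul_le_one₀ (abs_term_le_one k n (l * n) A ω) (abs_nonneg _)
      ((abs_of_nonneg measureReal_nonneg).trans_le measureReal_le_one)
  · filter_upwards [ae_subset] with ω hω
    by_cases hA : IsTightPocket k n (l * n) ω A
    · have hq := qKill_le_hybridProb (k := k) hl hn hω hA.1 hA.2.1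
      rw [mul_comm]
      exact mul_le_mul_of_nonneg_left hq (term_nonneg k n (l * n) A ω)
    · rw [Set.indicator_of_notMem (show ω ∉ {ξ : BondConfig (Site 3) | IsTightPocket k n (l * n) ξ A} from hA),
        mul_zero, zero_mul]

/-- C4b: the restricted integral of `D` as a sum of per-pocket integrals against `𝟙_F`. -/
theorem setIntegral_livenessMass (k n m : ℕ) {F : Set (BondConfig (Site 3))} (hF : MeasurableSet F) :
    ∫ ω in F, livenessMass k n m ω ∂μc =
      ∑ A ∈ (box 3 m).powerset,
        ∫ ω, {ξ : BondConfig (Site 3) | IsTightPocket k n m ξ A}.indicator (revival k n m A) ω *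
          F.indicator (fun _ => (1 : ℝ)) ω ∂μc := by
  rw [← integral_indicator hF]
  have hpt : ∀ ω, F.indicator (livenessMass k n m) ω =
      ∑ A ∈ (box 3 m).powerset,
        {ξ : BondConfig (Site 3) | IsTightPocket k n m ξ A}.indicator (revival k n m A) ω *
          F.indicator (fun _ => (1 : ℝ)) ω := by
    intro ω
    by_cases h : ω ∈ F
    · rw [Set.indicator_of_mem h, Set.indicator_of_mem h]
      unfold livenessMass
      simp
    · rw [Set.indicator_of_notMem h, Set.indicator_of_notMem h]
      simp
  simp_rw [hpt]
  refine integral_finsetSum _ fun A _ => ?_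
  refine integrable_of_abs_le ((measurable_term k n m A).mul (measurable_const.indicator hF)) (C := 1) fun ω => ?_
  rw [abs_mul]
  refine mul_le_one₀ (abs_term_le_one k n m A ω) (abs_nonneg _) ?_
  by_cases h : ω ∈ F
  · rw [Set.indicator_of_mem h]; simp
  · rw [Set.indicator_of_notMem h]; simp

/-- `n < l n` for `l ≥ 2`, `n ≥ 1`. -/
theorem lt_mul_of_two_le {n l : ℕ} (hl : 2 ≤ l) (hn : 1 ≤ n) : n < l * n := by
  nlinarith

/-- **C4**: the kill inequality `q · P(exact) ≤ ∫_{bEv k n (2ln)} D`. -/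
theorem kill_inequality {k n l : ℕ} (hl : 2 ≤ l) (hn : 1 ≤ n) :
    qKill * μc.real (exactEv k n (l * n)) ≤ ∫ ω in bEv k n (2 * l * n), livenessMass k n (l * n) ω ∂μc := by
  rw [← integral_livenessMass_eq (lt_mul_of_two_le hl hn), integral_livenessMass,
    setIntegral_livenessMass k n (l * n) (measurableSet_bEv k n (2 * l * n)), Finset.mul_sum]
  exact Finset.sum_le_sum fun A _ => qKill_mul_integral_term_le hl hn A

/-! ### §2.8 C5: `{D > 1} ⊆ {budget ≤ k}` almost surely -/

/-- C5a: if all tight pockets of `ω` coincide then `D ω ≤ 1`. -/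
theorem livenessMass_le_one_of_subsingleton {k n m : ℕ} {ω : BondConfig (Site 3)}
    (h : ∀ A B : Finset (Site 3), IsTightPocket k n m ω A → IsTightPocket k n m ω B → A = B) :
    livenessMass k n m ω ≤ 1 := by
  unfold livenessMass
  by_cases hex : ∃ A ∈ (box 3 m).powerset, IsTightPocket k n m ω A
  · obtain ⟨A₀, hA₀mem, hA₀⟩ := hex
    rw [Finset.sum_eq_single_of_mem A₀ hA₀mem]
    · exact term_le_one k n m A₀ ω
    · intro A _ hne
      exact Set.indicator_of_notMem
        (show ω ∉ {ξ : BondConfig (Site 3) | IsTightPocket k n m ξ A} from fun hA => hne (h A A₀ hA hA₀)) _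
  · push Not at hex
    refine (Finset.sum_eq_zero fun A hA => ?_).trans_le zero_le_one
    exact Set.indicator_of_notMem (show ω ∉ {ξ : BondConfig (Site 3) | IsTightPocket k n m ξ A} from hex A hA) _

/-- **C5**: `{D > 1} ⊆ bEv k` almost surely (two distinct tight pockets force the decrement). -/
theorem ae_mem_bEv_of_one_lt_livenessMass (k n m : ℕ) :
    ∀ᵐ ω ∂μc, 1 < livenessMass k n m ω → ω ∈ bEv k n m := by
  filter_upwards [ae_subset] with ω hω hlt
  by_contra hnot
  have h : ∀ A B : Finset (Site 3), IsTightPocket k n m ω A → IsTightPocket k n m ω B → A = B := by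
    intro A B hA hB
    by_contra hne
    exact hnot (mem_bEv_of_two_tightPockets hω hA hB hne)
  exact absurd hlt (not_lt.2 (livenessMass_le_one_of_subsingleton h))

/-- **Stub 7 (lever bookkeeping; provable from stubs 1–4 + §2; held by the lead and discharged in this file as the
wave lands).**  For `l ≥ 2`, `n ≥ 1`, with `D = livenessMass k n (ln)`: (i) `D` is measurable, (ii) `0 ≤ D ≤ 2^{#box(ln)}`,
(iii) `{D > 1} ⊆ bEv k n (ln)` a.s. (two distinct tight pockets), (iv) the kill inequality
`q · P(exact) ≤ ∫_{bEv k n (2ln)} D` (disintegration per pocket + door kill + the identity `E[D] = P(exact)`). -/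
theorem leverBookkeeping :
    ∀ (k n l : ℕ), 2 ≤ l → 1 ≤ n →
      Measurable (livenessMass k n (l * n)) ∧
      (∀ ω, 0 ≤ livenessMass k n (l * n) ω ∧ livenessMass k n (l * n) ω ≤ (2 : ℝ) ^ (box 3 (l * n)).card) ∧
      (∀ᵐ ω ∂μc, 1 < livenessMass k n (l * n) ω → ω ∈ bEv k n (l * n)) ∧
      qKill * μc.real (exactEv k n (l * n)) ≤ ∫ ω in bEv k n (2 * l * n), livenessMass k n (l * n) ω ∂μc := by
  intro k n l hl hn
  exact ⟨measurable_livenessMass k n (l * n),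
    fun ω => ⟨livenessMass_nonneg k n (l * n) ω, livenessMass_le k n (l * n) ω⟩,
    ae_mem_bEv_of_one_lt_livenessMass k n (l * n), kill_inequality hl hn⟩

/-! ## §3 Composition (sorry-free) -/

/-- The bet, over the named objects (definitional unfolding of `stub_secondMomentLiveness`). -/
theorem secondMoment_named (k l : ℕ) (hl : 2 ≤ l) :
    ∃ K : ℝ, ∀ n : ℕ, 1 ≤ n → ∫ ω, (livenessMass k n (l * n) ω) ^ 2 ∂μc ≤ K :=
  stub_secondMomentLiveness k l hl  -- definitional (all §0 objects are plain `def`s over the inline terms)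

/-- `q = (1 - p_c)^5 > 0`. -/
theorem qKill_pos : 0 < qKill := by
  unfold qKill
  have := pc_lt_one
  positivity

/-- Budget monotonicity `bEv k ⊆ bEv (k+1)`. -/
theorem bEv_subset_succ (k n m : ℕ) : bEv k n m ⊆ bEv (k + 1) n m :=
  blockedEv_mono_budget (Nat.le_succ k) n m

/-- `P(bEv (k+1)) = P(bEv k) + P(exact)`. -/
theorem real_bEv_succ (k n m : ℕ) :
    μc.real (bEv (k + 1) n m) = μc.real (bEv k n m) + μc.real (exactEv k n m) := by
  have hunion : bEv (k + 1) n m = bEv k n m ∪ exactEv k n m := by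
    rw [exactEv, Set.union_sdiff_cancel (bEv_subset_succ k n m)]
  have hdisj : Disjoint (bEv k n m) (exactEv k n m) := Set.disjoint_sdiff_right
  rw [hunion, measureReal_union hdisj ((measurableSet_blockedEv (k + 1) n m).diff (measurableSet_blockedEv k n m))]

/-- **Level `k` of the crux from a second-moment bound** (same-shape dichotomy + kill + Cauchy–Schwarz). -/
theorem levelStep_of_secondMoment (k l : ℕ) (c : ℝ) (hl : 2 ≤ l) (hc : 0 < c)
    (hK : ∃ K : ℝ, ∀ n : ℕ, 1 ≤ n → ∫ ω, (livenessMass k n (l * n) ω) ^ 2 ∂μc ≤ K) :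
    ∃ c' : ℝ, 0 < c' ∧ ∀ n : ℕ, 1 ≤ n →
      c ≤ μc.real (bEv (k + 1) n (l * n)) → c' ≤ μc.real (bEv k n (2 * l * n)) := by
  obtain ⟨K, hK⟩ := hK
  set K' : ℝ := max K 1 with hK'
  have hK'pos : 0 < K' := lt_of_lt_of_le one_pos (le_max_right _ _)
  set q : ℝ := qKill with hq
  have hqpos : 0 < q := qKill_pos
  refine ⟨min (c / 2) (min (q * c / 4) ((q * c / 4) ^ 2 / K')), ?_, ?_⟩
  · have h1 : 0 < q * c / 4 := by positivity
    have h2 : 0 < (q * c / 4) ^ 2 / K' := by positivity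
    exact lt_min (by linarith) (lt_min h1 h2)
  intro n hn hprem
  obtain ⟨hmeas, hbdd, hD1, hkill⟩ := leverBookkeeping k n l hl hn
  -- notation
  set P₀ : ℝ := μc.real (bEv k n (l * n)) with hP₀
  set P₂ : ℝ := μc.real (bEv k n (2 * l * n)) with hP₂
  set m₁ : ℝ := μc.real (exactEv k n (l * n)) with hm₁
  have hP₀P₂ : P₀ ≤ P₂ := blockProb_mono_aspect (k := k) (by nlinarith) (by nlinarith)
  have hsplit : μc.real (bEv (k + 1) n (l * n)) = P₀ + m₁ := real_bEv_succ k n (l * n)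
  have hP₀nn : 0 ≤ P₀ := measureReal_nonneg
  -- the arithmetic stub with D = livenessMass, F = bEv k n (2ln), G = bEv k n (ln)
  have hKn : ∫ ω, (livenessMass k n (l * n) ω) ^ 2 ∂μc ≤ K' := (hK n hn).trans (le_max_left _ _)
  have harith := stub_leverArithmetic (livenessMass k n (l * n)) (bEv k n (2 * l * n)) (bEv k n (l * n)) K'
    ((2 : ℝ) ^ (box 3 (l * n)).card) hmeas (fun ω => (hbdd ω).1) (fun ω => (hbdd ω).2)
    (measurableSet_blockedEv k n (2 * l * n)) (measurableSet_blockedEv k n (l * n)) hD1 hKn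
  -- so: q m₁ ≤ P₂ + √(K' P₀)
  have hmain : q * m₁ ≤ P₂ + Real.sqrt (K' * P₀) := hkill.trans harith
  by_cases hcase : c / 2 ≤ P₀
  · have hmin : min (c / 2) (min (q * c / 4) ((q * c / 4) ^ 2 / K')) ≤ c / 2 := min_le_left _ _
    exact hmin.trans (hcase.trans hP₀P₂)
  · push Not at hcase
    have hm₁ : c / 2 ≤ m₁ := by linarith only [hcase, hprem, hsplit]
    have hqm : q * c / 2 ≤ q * m₁ := by nlinarith only [hm₁, hqpos]
    by_cases hcase2 : (q * c / 4) ^ 2 / K' ≤ P₀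
    · have hmin : min (c / 2) (min (q * c / 4) ((q * c / 4) ^ 2 / K')) ≤ (q * c / 4) ^ 2 / K' :=
        (min_le_right _ _).trans (min_le_right _ _)
      exact hmin.trans (hcase2.trans hP₀P₂)
    · push Not at hcase2
      -- √(K' P₀) < q c / 4
      have hsqrt : Real.sqrt (K' * P₀) < q * c / 4 := by
        have hlt : K' * P₀ < (q * c / 4) ^ 2 := by
          have := (lt_div_iff₀ hK'pos).1 hcase2
          linarith only [this]
        have hqc : 0 ≤ q * c / 4 := by positivity
        calc Real.sqrt (K' * P₀) < Real.sqrt ((q * c / 4) ^ 2) :=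
              Real.sqrt_lt_sqrt (mul_nonneg hK'pos.le hP₀nn) hlt
          _ = q * c / 4 := Real.sqrt_sq hqc
      have hfin : q * c / 4 ≤ P₂ := by linarith only [hmain, hqm, hsqrt]
      have hmin : min (c / 2) (min (q * c / 4) ((q * c / 4) ^ 2 / K')) ≤ q * c / 4 :=
        (min_le_right _ _).trans (min_le_left _ _)
      exact hmin.trans hfin


/-! ### §3b The reduction from UNIFORM INTEGRABILITY of the liveness mass (weaker than a second moment) -/

/-- Tail splitting: for `0 ≤ D` measurable and bounded, `{D > 1} ⊆ G` a.s. and `K ≥ 1`: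
`∫_F D ≤ P(F) + K·P(G) + ∫_{D > K} D`. -/
theorem setIntegral_le_of_tail {D : BondConfig (Site 3) → ℝ} {F G : Set (BondConfig (Site 3))} {K B : ℝ}
    (hDm : Measurable D) (hD0 : ∀ ω, 0 ≤ D ω) (hDB : ∀ ω, D ω ≤ B) (hF : MeasurableSet F) (hG : MeasurableSet G)
    (hDG : ∀ᵐ ω ∂μc, 1 < D ω → ω ∈ G) (hK : 1 ≤ K) :
    ∫ ω in F, D ω ∂μc ≤ μc.real F + K * μc.real G + ∫ ω in {ω | K < D ω}, D ω ∂μc := by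
  have hT : MeasurableSet {ω : BondConfig (Site 3) | K < D ω} := measurableSet_lt measurable_const hDm
  have hint : ∀ {s : Set (BondConfig (Site 3))}, MeasurableSet s → Integrable (s.indicator D) μc := by
    intro s hs
    refine (Integrable.of_bound (hDm.aestronglyMeasurable) B (ae_of_all _ fun ω => ?_)).indicator hs
    rw [Real.norm_eq_abs, abs_of_nonneg (hD0 ω)]; exact hDB ω
  -- pointwise a.e.: D·𝟙_F ≤ 𝟙_F + K·𝟙_G + D·𝟙_{D > K}
  have hpt : ∀ᵐ ω ∂μc, F.indicator D ω ≤
      F.indicator (fun _ => (1 : ℝ)) ω + K * G.indicator (fun _ => (1 : ℝ)) ω + {ω | K < D ω}.indicator D ω := by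
    filter_upwards [hDG] with ω hω
    by_cases hωF : ω ∈ F
    · rw [Set.indicator_of_mem hωF, Set.indicator_of_mem hωF]
      by_cases h1 : D ω ≤ 1
      · have hG0 : 0 ≤ K * G.indicator (fun _ => (1 : ℝ)) ω :=
          mul_nonneg (by linarith) (Set.indicator_nonneg (fun _ _ => zero_le_one) ω)
        have hT0 : 0 ≤ {ω | K < D ω}.indicator D ω := Set.indicator_nonneg (fun ω _ => hD0 ω) ω
        linarith
      · push Not at h1
        have hωG : ω ∈ G := hω h1
        rw [Set.indicator_of_mem hωG, mul_one]
        by_cases hK' : K < D ω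
        · rw [Set.indicator_of_mem (show ω ∈ {ω | K < D ω} from hK')]
          linarith
        · rw [Set.indicator_of_notMem (show ω ∉ {ω | K < D ω} from hK')]
          push Not at hK'
          linarith
    · rw [Set.indicator_of_notMem hωF, Set.indicator_of_notMem hωF]
      have hG0 : 0 ≤ K * G.indicator (fun _ => (1 : ℝ)) ω :=
        mul_nonneg (by linarith) (Set.indicator_nonneg (fun _ _ => zero_le_one) ω)
      have hT0 : 0 ≤ {ω | K < D ω}.indicator D ω := Set.indicator_nonneg (fun ω _ => hD0 ω) ω
      linarith
  have hI1 : Integrable (fun ω => F.indicator (fun _ => (1 : ℝ)) ω) μc := (integrable_const 1).indicator hF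
  have hI2 : Integrable (fun ω => K * G.indicator (fun _ => (1 : ℝ)) ω) μc :=
    ((integrable_const 1).indicator hG).const_mul K
  have hI3 : Integrable (fun ω => {ω | K < D ω}.indicator D ω) μc := hint hT
  have hI12 : Integrable (fun ω => F.indicator (fun _ => (1 : ℝ)) ω + K * G.indicator (fun _ => (1 : ℝ)) ω) μc :=
    hI1.add hI2
  have hI123 : Integrable (fun ω => F.indicator (fun _ => (1 : ℝ)) ω + K * G.indicator (fun _ => (1 : ℝ)) ω +
      {ω | K < D ω}.indicator D ω) μc := hI12.add hI3
  have hmono := integral_mono_ae (hint hF) hI123 hpt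
  have e1 := integral_add hI12 hI3
  have e2 := integral_add hI1 hI2
  beta_reduce at hmono e1 e2
  have e3' : ∫ ω, G.indicator (fun _ => (1 : ℝ)) ω ∂μc = μc.real G := integral_indicator_one hG
  have e3 : ∫ ω, K * G.indicator (fun _ => (1 : ℝ)) ω ∂μc = K * μc.real G := by
    rw [integral_const_mul, e3']
  have e4 : ∫ ω, F.indicator (fun _ => (1 : ℝ)) ω ∂μc = μc.real F := integral_indicator_one hF
  have e5 : ∫ ω, {ω | K < D ω}.indicator D ω ∂μc = ∫ ω in {ω | K < D ω}, D ω ∂μc := integral_indicator hT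
  have e6 : ∫ ω, F.indicator D ω ∂μc = ∫ ω in F, D ω ∂μc := integral_indicator hF
  linarith [hmono, e1, e2, e3, e4, e5, e6]

/-- **Level `k` of the crux from UNIFORM INTEGRABILITY of the liveness mass** (`∫_{D > K} D ≤ ε` uniformly in `n`):
`c' = min(c/2, qc/4, qc/(8·max(K,1)))` with `K = K(k, l, qc/8)`. -/
theorem levelStep_of_uniformIntegrable (k l : ℕ) (c : ℝ) (hl : 2 ≤ l) (hc : 0 < c)
    (hUI : ∀ ε : ℝ, 0 < ε → ∃ K : ℝ, ∀ n : ℕ, 1 ≤ n →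
      ∫ ω in {ω | K < livenessMass k n (l * n) ω}, livenessMass k n (l * n) ω ∂μc ≤ ε) :
    ∃ c' : ℝ, 0 < c' ∧ ∀ n : ℕ, 1 ≤ n →
      c ≤ μc.real (bEv (k + 1) n (l * n)) → c' ≤ μc.real (bEv k n (2 * l * n)) := by
  set q : ℝ := qKill with hq
  have hqpos : 0 < q := qKill_pos
  obtain ⟨K, hK⟩ := hUI (q * c / 8) (by positivity)
  set K' : ℝ := max K 1 with hK'
  have hK'1 : 1 ≤ K' := le_max_right _ _
  have hK'pos : 0 < K' := lt_of_lt_of_le one_pos hK'1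
  refine ⟨min (c / 2) (min (q * c / 4) (q * c / (8 * K'))), ?_, ?_⟩
  · have h1 : 0 < q * c / 4 := by positivity
    have h2 : 0 < q * c / (8 * K') := by positivity
    exact lt_min (by linarith) (lt_min h1 h2)
  intro n hn hprem
  obtain ⟨hmeas, hbdd, hD1, hkill⟩ := leverBookkeeping k n l hl hn
  set P₀ : ℝ := μc.real (bEv k n (l * n)) with hP₀
  set P₂ : ℝ := μc.real (bEv k n (2 * l * n)) with hP₂
  set m₁ : ℝ := μc.real (exactEv k n (l * n)) with hm₁
  have hP₀P₂ : P₀ ≤ P₂ := blockProb_mono_aspect (k := k) (by nlinarith) (by nlinarith)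
  have hsplit : μc.real (bEv (k + 1) n (l * n)) = P₀ + m₁ := real_bEv_succ k n (l * n)
  have hP₀nn : 0 ≤ P₀ := measureReal_nonneg
  -- the tail beyond K' is at most the tail beyond K
  have htail : ∫ ω in {ω | K' < livenessMass k n (l * n) ω}, livenessMass k n (l * n) ω ∂μc ≤ q * c / 8 := by
    refine le_trans ?_ (hK n hn)
    apply setIntegral_mono_set
    · refine Integrable.integrableOn (Integrable.of_bound hmeas.aestronglyMeasurable ((2 : ℝ) ^ (box 3 (l * n)).card)
        (ae_of_all _ fun ω => ?_))
      rw [Real.norm_eq_abs, abs_of_nonneg (hbdd ω).1]; exact (hbdd ω).2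
    · exact ae_of_all _ fun ω => (hbdd ω).1
    · exact ae_of_all _ fun ω (hω : K' < livenessMass k n (l * n) ω) =>
        show K < livenessMass k n (l * n) ω from lt_of_le_of_lt (le_max_left K 1) hω
  have harith := setIntegral_le_of_tail (F := bEv k n (2 * l * n)) (G := bEv k n (l * n)) hmeas
    (fun ω => (hbdd ω).1) (fun ω => (hbdd ω).2) (measurableSet_blockedEv k n (2 * l * n))
    (measurableSet_blockedEv k n (l * n)) hD1 hK'1
  have hmain : q * m₁ ≤ P₂ + K' * P₀ + q * c / 8 := hkill.trans (harith.trans (by linarith))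
  by_cases hcase : c / 2 ≤ P₀
  · exact (min_le_left _ _).trans (hcase.trans hP₀P₂)
  · push Not at hcase
    have hm₁ : c / 2 ≤ m₁ := by linarith only [hcase, hprem, hsplit]
    have hqm : q * c / 2 ≤ q * m₁ := by nlinarith only [hm₁, hqpos]
    by_cases hcase2 : q * c / (8 * K') ≤ P₀
    · exact ((min_le_right _ _).trans (min_le_right _ _)).trans (hcase2.trans hP₀P₂)
    · push Not at hcase2
      have hKP : K' * P₀ < q * c / 8 := by
        have := (lt_div_iff₀ (by positivity : (0 : ℝ) < 8 * K')).1 hcase2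
        nlinarith only [this, hK'pos]
      have hfin : q * c / 4 ≤ P₂ := by linarith only [hmain, hqm, hKP]
      exact ((min_le_right _ _).trans (min_le_left _ _)).trans hfin


/-! ### §3c The crux's level `k` is EQUIVALENT to a uniform conditional-mean bound for the liveness mass

Honest calibration of the line: by the kill inequality (⇐, no Cauchy–Schwarz needed) and by `∫ D ≤ 1` (⇒, trivial), level `k`
of the crux at aspect `l` is equivalent to "under the premise, `∫_{bEv k n 2ln} D ≤ K · P(bEv k n 2ln)` uniformly in `n`".  So the
L² / UI bets are STRENGTHENINGS of the crux's own conclusion recast as moment bounds of one functional — their only advantage is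
that `E[D²]` is a three-replica quantity (pairs of pockets revived by independent exteriors) that can be estimated without knowing the
blocked probability. -/

/-- `∫_G D ≤ 1` for every event `G` (from `D ≥ 0` and the liveness identity `∫ D = P(exact) ≤ 1`). -/
theorem setIntegral_livenessMass_le_one {k n l : ℕ} (hl : 2 ≤ l) (hn : 1 ≤ n) (G : Set (BondConfig (Site 3))) :
    ∫ ω in G, livenessMass k n (l * n) ω ∂μc ≤ 1 := by
  have hint : Integrable (livenessMass k n (l * n)) μc := by
    refine Integrable.of_bound (measurable_livenessMass k n (l * n)).aestronglyMeasurable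
      ((2 : ℝ) ^ (box 3 (l * n)).card) (ae_of_all _ fun ω => ?_)
    rw [Real.norm_eq_abs, abs_of_nonneg (livenessMass_nonneg k n (l * n) ω)]
    exact livenessMass_le k n (l * n) ω
  calc ∫ ω in G, livenessMass k n (l * n) ω ∂μc ≤ ∫ ω, livenessMass k n (l * n) ω ∂μc :=
        setIntegral_le_integral hint (ae_of_all _ fun ω => livenessMass_nonneg k n (l * n) ω)
    _ = μc.real (exactEv k n (l * n)) := integral_livenessMass_eq (lt_mul_of_two_le hl hn)
    _ ≤ 1 := measureReal_le_one

/-- **Level `k` of the crux at aspect `l` ⟺ a uniform bound on the conditional mean of the liveness mass on the doubled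
blocked event** (under the premise).  `⇐`: dichotomy + kill inequality; `⇒`: `∫_G D ≤ 1 ≤ P(G)/c'`. -/
theorem levelStep_iff_condMean (k l : ℕ) (hl : 2 ≤ l) :
    (∀ c : ℝ, 0 < c → ∃ c' : ℝ, 0 < c' ∧ ∀ n : ℕ, 1 ≤ n →
        c ≤ μc.real (bEv (k + 1) n (l * n)) → c' ≤ μc.real (bEv k n (2 * l * n))) ↔
    (∀ c : ℝ, 0 < c → ∃ K : ℝ, ∀ n : ℕ, 1 ≤ n → c ≤ μc.real (bEv (k + 1) n (l * n)) →
        ∫ ω in bEv k n (2 * l * n), livenessMass k n (l * n) ω ∂μc ≤ K * μc.real (bEv k n (2 * l * n))) := by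
  constructor
  · intro h c hc
    obtain ⟨c', hc', H⟩ := h c hc
    refine ⟨1 / c', fun n hn hprem => ?_⟩
    have hP : c' ≤ μc.real (bEv k n (2 * l * n)) := H n hn hprem
    have h1 : ∫ ω in bEv k n (2 * l * n), livenessMass k n (l * n) ω ∂μc ≤ 1 :=
      setIntegral_livenessMass_le_one hl hn _
    have h2 : 1 ≤ 1 / c' * μc.real (bEv k n (2 * l * n)) := by
      rw [div_mul_eq_mul_div, one_mul, le_div_iff₀ hc']; linarith
    linarith
  · intro h c hc
    obtain ⟨K, hK⟩ := h c hc
    set K' : ℝ := max K 1 with hK'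
    have hK'pos : 0 < K' := lt_of_lt_of_le one_pos (le_max_right _ _)
    set q : ℝ := qKill with hq
    have hqpos : 0 < q := qKill_pos
    refine ⟨min (c / 2) (q * c / (2 * K')), lt_min (by linarith) (by positivity), fun n hn hprem => ?_⟩
    obtain ⟨-, -, -, hkill⟩ := leverBookkeeping k n l hl hn
    set P₀ : ℝ := μc.real (bEv k n (l * n)) with hP₀
    set P₂ : ℝ := μc.real (bEv k n (2 * l * n)) with hP₂
    set m₁ : ℝ := μc.real (exactEv k n (l * n)) with hm₁
    have hP₀P₂ : P₀ ≤ P₂ := blockProb_mono_aspect (k := k) (by nlinarith) (by nlinarith)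
    have hsplit : μc.real (bEv (k + 1) n (l * n)) = P₀ + m₁ := real_bEv_succ k n (l * n)
    have hP₂nn : 0 ≤ P₂ := measureReal_nonneg
    have hKn : ∫ ω in bEv k n (2 * l * n), livenessMass k n (l * n) ω ∂μc ≤ K' * P₂ :=
      (hK n hn hprem).trans (mul_le_mul_of_nonneg_right (le_max_left _ _) hP₂nn)
    have hmain : q * m₁ ≤ K' * P₂ := hkill.trans hKn
    by_cases hcase : c / 2 ≤ P₀
    · exact (min_le_left _ _).trans (hcase.trans hP₀P₂)
    · push Not at hcase
      have hm₁ : c / 2 ≤ m₁ := by linarith only [hcase, hprem, hsplit]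
      have hqm : q * c / 2 ≤ K' * P₂ := by nlinarith only [hm₁, hqpos, hmain]
      have hfin : q * c / (2 * K') ≤ P₂ := by
        rw [div_le_iff₀ (by positivity)]; nlinarith only [hqm, hK'pos]
      exact (min_le_right _ _).trans hfin

/-- **Level `k` of the crux from the registered stubs.** -/
theorem levelStep_of_stubs (k l : ℕ) (c : ℝ) (hl : 2 ≤ l) (hc : 0 < c) :
    ∃ c' : ℝ, 0 < c' ∧ ∀ n : ℕ, 1 ≤ n →
      c ≤ μc.real (bEv (k + 1) n (l * n)) → c' ≤ μc.real (bEv k n (2 * l * n)) :=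
  levelStep_of_secondMoment k l c hl hc (secondMoment_named k l hl)

/-- **The crux from the registered stubs.** -/
theorem PinholeClosing_of : PercBudgetLadder.PinholeClosing :=
  pinholeClosing_iff_bEv.2 fun k l c hl hc => levelStep_of_stubs k l c hl hc

#print axioms PinholeClosing_of

/-! ## §4 Auxiliary LANDING registrations (def-free restatements of proved §2–§3 results; registered with
`ledger workitem stub-add` so that the objects/bookkeeping/reduction files can land `--supports` the crux) -/

/-- **Aux stub A (two pockets ⇒ decrement, a.s.; def-free form of C5)** — proved: `leverBookkeeping ….2.2.1`. -/
theorem stub_pocketTwoPockets :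
    ∀ (k n l : ℕ), 2 ≤ l → 1 ≤ n →
      ∀ᵐ ω ∂(bondPercolation (zdGraph 3) (criticalProbI 3)),
        1 < (∑ A ∈ (box 3 (l * n)).powerset,
          {ξ : BondConfig (Site 3) |
          (box 3 n ⊆ A ∧ A ⊆ box 3 (l * n) \ innerBoundary (zdGraph 3) (box 3 (l * n))) ∧
          ((edgeBoundary (zdGraph 3) A).filter (· ∈ ξ)).card ≤ k + 1 ∧
          ∀ A' : Finset (Site 3), (box 3 n ⊆ A' ∧ A' ⊆ box 3 (l * n) \ innerBoundary (zdGraph 3) (box 3 (l * n))) →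
          A' ⊂ A → k + 2 ≤ ((edgeBoundary (zdGraph 3) A').filter (· ∈ ξ)).card}.indicator
          (fun ξ : BondConfig (Site 3) => (bondPercolation (zdGraph 3) (criticalProbI 3)).real
          {ω' : BondConfig (Site 3) |
          (ξ ∩ ↑(edgesTouching (zdGraph 3) A)) ∪ (ω' \ ↑(edgesTouching (zdGraph 3) A)) ∈
          {ζ : BondConfig (Site 3) | ∃ S : Finset (Sym2 (Site 3)), S.card ≤ k + 1 ∧ ¬ ∃ x ∈ box 3 n,
          ∃ y ∈ innerBoundary (zdGraph 3) (box 3 (l * n)),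
          (ζ \ (↑S : Set (Sym2 (Site 3)))) ∈ openConnIn (↑(box 3 (l * n)) : Set (Site 3)) x y} \
          {ζ : BondConfig (Site 3) | ∃ S : Finset (Sym2 (Site 3)), S.card ≤ k ∧ ¬ ∃ x ∈ box 3 n,
          ∃ y ∈ innerBoundary (zdGraph 3) (box 3 (l * n)),
          (ζ \ (↑S : Set (Sym2 (Site 3)))) ∈ openConnIn (↑(box 3 (l * n)) : Set (Site 3)) x y}})
          ω) →
        ω ∈ {ζ : BondConfig (Site 3) | ∃ S : Finset (Sym2 (Site 3)), S.card ≤ k ∧ ¬ ∃ x ∈ box 3 n,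
            ∃ y ∈ innerBoundary (zdGraph 3) (box 3 (l * n)),
              (ζ \ (↑S : Set (Sym2 (Site 3)))) ∈ openConnIn (↑(box 3 (l * n)) : Set (Site 3)) x y} :=
  fun k n l hl hn => (leverBookkeeping k n l hl hn).2.2.1

/-- **Aux stub B (the kill inequality with the liveness identity folded in; def-free form of C4)** — proved:
`leverBookkeeping ….2.2.2`. -/
theorem stub_pocketKill :
    ∀ (k n l : ℕ), 2 ≤ l → 1 ≤ n →
      (1 - ((criticalProbI 3 : unitInterval) : ℝ)) ^ 5 *
          (bondPercolation (zdGraph 3) (criticalProbI 3)).real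
            ({ζ : BondConfig (Site 3) | ∃ S : Finset (Sym2 (Site 3)), S.card ≤ k + 1 ∧ ¬ ∃ x ∈ box 3 n,
            ∃ y ∈ innerBoundary (zdGraph 3) (box 3 (l * n)),
              (ζ \ (↑S : Set (Sym2 (Site 3)))) ∈ openConnIn (↑(box 3 (l * n)) : Set (Site 3)) x y} \
            {ζ : BondConfig (Site 3) | ∃ S : Finset (Sym2 (Site 3)), S.card ≤ k ∧ ¬ ∃ x ∈ box 3 n,
            ∃ y ∈ innerBoundary (zdGraph 3) (box 3 (l * n)),
              (ζ \ (↑S : Set (Sym2 (Site 3)))) ∈ openConnIn (↑(box 3 (l * n)) : Set (Site 3)) x y}) ≤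
        ∫ ω in {ζ : BondConfig (Site 3) | ∃ S : Finset (Sym2 (Site 3)), S.card ≤ k ∧ ¬ ∃ x ∈ box 3 n,
            ∃ y ∈ innerBoundary (zdGraph 3) (box 3 (2 * l * n)),
              (ζ \ (↑S : Set (Sym2 (Site 3)))) ∈ openConnIn (↑(box 3 (2 * l * n)) : Set (Site 3)) x y},
          (∑ A ∈ (box 3 (l * n)).powerset,
          {ξ : BondConfig (Site 3) |
          (box 3 n ⊆ A ∧ A ⊆ box 3 (l * n) \ innerBoundary (zdGraph 3) (box 3 (l * n))) ∧
          ((edgeBoundary (zdGraph 3) A).filter (· ∈ ξ)).card ≤ k + 1 ∧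
          ∀ A' : Finset (Site 3), (box 3 n ⊆ A' ∧ A' ⊆ box 3 (l * n) \ innerBoundary (zdGraph 3) (box 3 (l * n))) →
          A' ⊂ A → k + 2 ≤ ((edgeBoundary (zdGraph 3) A').filter (· ∈ ξ)).card}.indicator
          (fun ξ : BondConfig (Site 3) => (bondPercolation (zdGraph 3) (criticalProbI 3)).real
          {ω' : BondConfig (Site 3) |
          (ξ ∩ ↑(edgesTouching (zdGraph 3) A)) ∪ (ω' \ ↑(edgesTouching (zdGraph 3) A)) ∈
          {ζ : BondConfig (Site 3) | ∃ S : Finset (Sym2 (Site 3)), S.card ≤ k + 1 ∧ ¬ ∃ x ∈ box 3 n,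
          ∃ y ∈ innerBoundary (zdGraph 3) (box 3 (l * n)),
          (ζ \ (↑S : Set (Sym2 (Site 3)))) ∈ openConnIn (↑(box 3 (l * n)) : Set (Site 3)) x y} \
          {ζ : BondConfig (Site 3) | ∃ S : Finset (Sym2 (Site 3)), S.card ≤ k ∧ ¬ ∃ x ∈ box 3 n,
          ∃ y ∈ innerBoundary (zdGraph 3) (box 3 (l * n)),
          (ζ \ (↑S : Set (Sym2 (Site 3)))) ∈ openConnIn (↑(box 3 (l * n)) : Set (Site 3)) x y}})
          ω) ∂(bondPercolation (zdGraph 3) (criticalProbI 3)) :=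
  fun k n l hl hn => (leverBookkeeping k n l hl hn).2.2.2

/-- **Aux stub C (THE CERTIFIED REDUCTION, def-free): the bet (for all `k`) implies the crux BY NAME.** -/
theorem stub_pocketReduction :
    (∀ (k l : ℕ), 2 ≤ l → ∃ K : ℝ, ∀ n : ℕ, 1 ≤ n →
      ∫ ω, (∑ A ∈ (box 3 (l * n)).powerset,
          {ξ : BondConfig (Site 3) |
          (box 3 n ⊆ A ∧ A ⊆ box 3 (l * n) \ innerBoundary (zdGraph 3) (box 3 (l * n))) ∧
          ((edgeBoundary (zdGraph 3) A).filter (· ∈ ξ)).card ≤ k + 1 ∧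
          ∀ A' : Finset (Site 3), (box 3 n ⊆ A' ∧ A' ⊆ box 3 (l * n) \ innerBoundary (zdGraph 3) (box 3 (l * n))) →
          A' ⊂ A → k + 2 ≤ ((edgeBoundary (zdGraph 3) A').filter (· ∈ ξ)).card}.indicator
          (fun ξ : BondConfig (Site 3) => (bondPercolation (zdGraph 3) (criticalProbI 3)).real
          {ω' : BondConfig (Site 3) |
          (ξ ∩ ↑(edgesTouching (zdGraph 3) A)) ∪ (ω' \ ↑(edgesTouching (zdGraph 3) A)) ∈
          {ζ : BondConfig (Site 3) | ∃ S : Finset (Sym2 (Site 3)), S.card ≤ k + 1 ∧ ¬ ∃ x ∈ box 3 n,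
          ∃ y ∈ innerBoundary (zdGraph 3) (box 3 (l * n)),
          (ζ \ (↑S : Set (Sym2 (Site 3)))) ∈ openConnIn (↑(box 3 (l * n)) : Set (Site 3)) x y} \
          {ζ : BondConfig (Site 3) | ∃ S : Finset (Sym2 (Site 3)), S.card ≤ k ∧ ¬ ∃ x ∈ box 3 n,
          ∃ y ∈ innerBoundary (zdGraph 3) (box 3 (l * n)),
          (ζ \ (↑S : Set (Sym2 (Site 3)))) ∈ openConnIn (↑(box 3 (l * n)) : Set (Site 3)) x y}})
          ω) ^ 2
        ∂(bondPercolation (zdGraph 3) (criticalProbI 3)) ≤ K) →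
    Summit.CriticalPhenomena.PercolationContinuityZ3.Theses.PercBudgetLadder.PinholeClosing :=
  fun h => pinholeClosing_iff_bEv.2 fun k l c hl hc => levelStep_of_secondMoment k l c hl hc (h k l hl)

#print axioms stub_pocketTwoPockets
#print axioms stub_pocketKill
#print axioms stub_pocketReduction

/-- **Aux stub D (THE CERTIFIED REDUCTION, UI form, def-free): uniform integrability of the liveness mass (for all
`k`) implies the crux BY NAME** — strictly weaker hypothesis than aux stub C. -/
theorem stub_pocketReductionUI :
    (∀ (k l : ℕ), 2 ≤ l → ∀ ε : ℝ, 0 < ε → ∃ K : ℝ, ∀ n : ℕ, 1 ≤ n →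
      ∫ ω in {ω : BondConfig (Site 3) | K <
            (∑ A ∈ (box 3 (l * n)).powerset,
              {ξ : BondConfig (Site 3) |
              (box 3 n ⊆ A ∧ A ⊆ box 3 (l * n) \ innerBoundary (zdGraph 3) (box 3 (l * n))) ∧
              ((edgeBoundary (zdGraph 3) A).filter (· ∈ ξ)).card ≤ k + 1 ∧
              ∀ A' : Finset (Site 3), (box 3 n ⊆ A' ∧ A' ⊆ box 3 (l * n) \ innerBoundary (zdGraph 3) (box 3 (l * n))) →
              A' ⊂ A → k + 2 ≤ ((edgeBoundary (zdGraph 3) A').filter (· ∈ ξ)).card}.indicator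
              (fun ξ : BondConfig (Site 3) => (bondPercolation (zdGraph 3) (criticalProbI 3)).real
              {ω' : BondConfig (Site 3) |
              (ξ ∩ ↑(edgesTouching (zdGraph 3) A)) ∪ (ω' \ ↑(edgesTouching (zdGraph 3) A)) ∈
              {ζ : BondConfig (Site 3) | ∃ S : Finset (Sym2 (Site 3)), S.card ≤ k + 1 ∧ ¬ ∃ x ∈ box 3 n,
              ∃ y ∈ innerBoundary (zdGraph 3) (box 3 (l * n)),
              (ζ \ (↑S : Set (Sym2 (Site 3)))) ∈ openConnIn (↑(box 3 (l * n)) : Set (Site 3)) x y} \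
              {ζ : BondConfig (Site 3) | ∃ S : Finset (Sym2 (Site 3)), S.card ≤ k ∧ ¬ ∃ x ∈ box 3 n,
              ∃ y ∈ innerBoundary (zdGraph 3) (box 3 (l * n)),
              (ζ \ (↑S : Set (Sym2 (Site 3)))) ∈ openConnIn (↑(box 3 (l * n)) : Set (Site 3)) x y}})
              ω)},
          (∑ A ∈ (box 3 (l * n)).powerset,
          {ξ : BondConfig (Site 3) |
          (box 3 n ⊆ A ∧ A ⊆ box 3 (l * n) \ innerBoundary (zdGraph 3) (box 3 (l * n))) ∧
          ((edgeBoundary (zdGraph 3) A).filter (· ∈ ξ)).card ≤ k + 1 ∧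
          ∀ A' : Finset (Site 3), (box 3 n ⊆ A' ∧ A' ⊆ box 3 (l * n) \ innerBoundary (zdGraph 3) (box 3 (l * n))) →
          A' ⊂ A → k + 2 ≤ ((edgeBoundary (zdGraph 3) A').filter (· ∈ ξ)).card}.indicator
          (fun ξ : BondConfig (Site 3) => (bondPercolation (zdGraph 3) (criticalProbI 3)).real
          {ω' : BondConfig (Site 3) |
          (ξ ∩ ↑(edgesTouching (zdGraph 3) A)) ∪ (ω' \ ↑(edgesTouching (zdGraph 3) A)) ∈
          {ζ : BondConfig (Site 3) | ∃ S : Finset (Sym2 (Site 3)), S.card ≤ k + 1 ∧ ¬ ∃ x ∈ box 3 n,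
          ∃ y ∈ innerBoundary (zdGraph 3) (box 3 (l * n)),
          (ζ \ (↑S : Set (Sym2 (Site 3)))) ∈ openConnIn (↑(box 3 (l * n)) : Set (Site 3)) x y} \
          {ζ : BondConfig (Site 3) | ∃ S : Finset (Sym2 (Site 3)), S.card ≤ k ∧ ¬ ∃ x ∈ box 3 n,
          ∃ y ∈ innerBoundary (zdGraph 3) (box 3 (l * n)),
          (ζ \ (↑S : Set (Sym2 (Site 3)))) ∈ openConnIn (↑(box 3 (l * n)) : Set (Site 3)) x y}})
          ω)
        ∂(bondPercolation (zdGraph 3) (criticalProbI 3)) ≤ ε) →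
    Summit.CriticalPhenomena.PercolationContinuityZ3.Theses.PercBudgetLadder.PinholeClosing :=
  fun h => pinholeClosing_iff_bEv.2 fun k l c hl hc => levelStep_of_uniformIntegrable k l c hl hc (h k l hl)

#print axioms stub_pocketReductionUI

end

end Summit.CriticalPhenomena.PercolationContinuityZ3.Cruxes.PinholeClosing.PocketResampling
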